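import Literature.MathematicalPhysics.QuantumFieldTheory.Balaban1983to89.B13ConditioningBlockWalks

/-!
# `Balaban1983to89.B13ConditioningSigmaLetters` — T. Bałaban, *Renormalization group approach to lattice gauge field
theories. II. Cluster expansions*, Commun. Math. Phys. **116** (1988) 1–22 [Balaban1988RG2Cluster], p. 3 (the
s-decoration of the walk terms), (1.11) p. 5, (2.7) p. 13, (2.14) p. 15: THE TWO STRUCTURAL LETTERS OF THE CONDITIONED
OPERATOR — complex symmetry and σ-holomorphy of `K = C*Δ_k(σ,𝐔,𝐉)C` — READ OFF ITS ONE JOINT WALK EXPANSION: σ-holomorphy of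
the kernel from TERMWISE σ-holomorphy (free when the terms are `s`-monomials times σ-free operators, print p. 3), symmetry
at complex `(σ,u)` from a REVERSAL of the walk family ([13] (3.107): the expansion of the symmetric operator is reversal-
invariant termwise); hence the letters `hAs`, `hAhol`, `hGhol` of the N10 record junctions for kernels read in block form
off `K` (`B13ConditioningBlockWalks`) follow from the ONE expansion, its reversal, the ONE positivity and print's two
perturbative thresholds

statement-level bookkeeping over published theorems with citation tags; kernel-checked compositions of tree theorems;
nothing here is a claim about the Yang–Mills mass gap.

PROVENANCE.  §1–§2 are the PORT, at the invitation of the memo cell «around Bałaban» (`ym-nodeO-ideate` P2 g28, bus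
`pub-ymgap/INBOX.md` 2026-08-27T01:08:12Z, «the ≈ 250-line port of companion 17 §1 §3 … is yours to write»), of §1 and §3
of its farm-checked companion 17 `run/shared/lean/pub/ym-nodeO-ideate/memos/ROUTE-P2-files/SketchSigmaRef.lean` (sha256
65074969…, memo ROUTE-P2 v3.36 S54, typed candidates T-54.1, T-54.2, T-54.5; namespace `YM.NodeO.P2.SigmaRef`) — statements
and proofs verbatim except (i) this Literature namespace, (ii) the open polydisc spelled as the set-builder
`{σ | ∀ j, σ j ∈ ball 0 ϱ}` of the record junctions (no `polydisc` definition; `B13ConditioningBlockWalks.setOf_forall_mem_ball_eq_ball`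
for the sup-norm ball), (iii) provenance tags.  §3 composes them with this seat's module 17 at the ONE conditioned operator.
The real-slice ∕ identity-theorem route to symmetry (companion 17 §4, T-54.6–T-54.8) is NOT ported here.

CITATION HEADER.  [II] p. 3 ll. 30–36: *"for a random walk ω localized in X̃₀⁵ ∪ … ∪ X̃ₙ⁵ we take the {Δ₁,…,Δ_m} of all
cubes from σ₀ which intersect this localization domain, and we multiply the term in (1.6) corresponding to ω by
∏_{j=1}^m s(Δ_j). This way the s-dependent propagators H(s), G(s), H₀(s) are defined."*; (1.11) p. 5 (the polydisc
`|s(Δ)| ≤ e^{κ₁}`); p. 15: *"We consider it as an analytic function of (𝐔, 𝐉) … and of the complex parameters σ(Z), τ"*,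
*"For the pair (U′, 0) the operators are symmetric, and the measure is positive"*; (2.7) p. 13.  [13] =
[Balaban1985BackgroundPropagators] CMP **99** (1985) Thm 3.10 (3.107)–(3.108) p. 416 (the expansion of the symmetric
operator `G` over walks; a reversed walk gives the transposed term).

WHAT THIS FILE PROVES (all `theorem`s; no `def`, no instance, no notation).
§1 `sigmaHol_of_termwise` (T-54.1) — a joint walk expansion (drop `ε ≥ 0`) whose TERMS are σ-holomorphic on the open
   `e^{κ₁}`-polydisc at a configuration `u` of the ball has a σ-holomorphic kernel there (Weierstrass through the tree's
   `B13ExpansionAnalytic.differentiableOn_of_hasSum` on the sup-norm ball); `differentiable_monomial`,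
   `sigmaHol_term_of_monomial` (T-54.2) — print's `s`-monomial terms make the termwise hypothesis free.
§2 `isSymm_of_hasSum_reversal`, `isSymm_of_reversal` (T-54.5) — a walk family with a reversal `rev`,
   `T_{rev ω}(σ,u) = T_ω(σ,u)ᵀ`, sums to a symmetric kernel on the CLOSED polydisc × ball.
§3 AT THE ONE CONDITIONED OPERATOR (module 17's block reading `hA2 ∕ hG2`): `isSymm_A2_of_reversal` (`hAs` from the
   reversal of `K`'s expansion), `differentiableOn_A2_of_termwise` (`hAhol` from termwise σ-holomorphy of `K`'s terms),
   `differentiableOn_G2_of_termwise` (`hGhol` from the same + the ONE reference positivity under print's two thresholds: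
   `sigmaHol_of_termwise` + `accretive_of_conditionedBlocks_at` + `differentiableOn_offBlock_mul_invSqrt_apply`), and the
   `s`-monomial editions `differentiableOn_A2_of_monomial` ∕ `differentiableOn_G2_of_monomial` (no regularity hypothesis
   left: the expansion's terms ARE `(∏_{j∈J_ω} σ_j)·T⁰_ω(u)`).
HONEST FRAMING: [folklore] function theory (Weierstrass M-test; `HasSum` under an `Equiv`) over the tree's
`B13ExpansionAnalytic` ∕ `B13Sqrt27Accretive` ∕ `B13JointWalkExpansion`; NOTHING of Bałaban's `C*Δ_k(σ,𝐔,𝐉)C` is constructed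
or asserted — that HIS expansion's terms are `s`-monomials in the tree's typing and carry a reversal is the (D4) supplier's
statement (print p. 3 and [13] (3.107) define them so); count-neutral; NOT a discharge of N10; no `sorry`, no new named
fact; standard axioms; nothing continuum ∕ ℝ⁴ ∕ OS ∕ mass gap ∕ Clay.
-/

noncomputable section

namespace Literature.MathematicalPhysics.QuantumFieldTheory.Balaban1983to89.B13ConditioningSigmaLetters

open Metric Set Finset Filter
open scoped Matrix Topology
open Literature.MathematicalPhysics.QuantumFieldTheory.Balaban1983to89
open Literature.MathematicalPhysics.QuantumFieldTheory.Balaban1983to89.B9Thm37GlueTorus (tdist1)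
open Literature.MathematicalPhysics.QuantumFieldTheory.Balaban1983to89.TreeLengthTorus (TPt)
open Literature.MathematicalPhysics.QuantumFieldTheory.Balaban1983to89.B5TorusCover (UT)
open Literature.MathematicalPhysics.QuantumFieldTheory.Balaban1983to89.B13JointWalkExpansion (JointWalkExpansion)
open Literature.MathematicalPhysics.QuantumFieldTheory.Balaban1983to89.B13ExpansionAnalytic (differentiableOn_of_hasSum)
open Literature.MathematicalPhysics.QuantumFieldTheory.Balaban1983to89.B13TermWalkData (TermKernels)
open Literature.MathematicalPhysics.QuantumFieldTheory.Balaban1983to89.B13Sqrt27Accretive (invSqrt)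
open Literature.MathematicalPhysics.QuantumFieldTheory.Balaban1983to89.NodeOLettersOfWalksPerturbative (RefPackage)
open Literature.MathematicalPhysics.QuantumFieldTheory.Balaban1983to89.B13ConditioningBlockWalks
  (isSymm_toBlocks₁₁ differentiableOn_toBlocks₁₁_apply differentiableOn_offBlock_mul_invSqrt_apply
    setOf_forall_mem_ball_eq_ball accretive_of_conditionedBlocks_at)

variable {d N' : ℕ} {ν : ℕ} {Nf : Fin ν → ℕ} [∀ i, NeZero (Nf i)]
variable {p n : Type}
variable {E : Type*} [NormedAddCommGroup E] [NormedSpace ℂ E]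

/-! ## §1. σ-holomorphy of a jointly walk-expanded kernel from TERMWISE σ-holomorphy -/

section Kernel

variable [NeZero N'] {c : B13.Consts} {locp : p → UT Nf} {locn : n → UT Nf} {K2 : (TPt d N' → ℂ) → E → Matrix p n ℂ}
variable {X : Finset (UT Nf)} {R ε kap Kbar : ℝ}
variable {W : Type} {T2 : W → (TPt d N' → ℂ) → E → Matrix p n ℂ} {SX : Set W} {A : W → ℝ}
variable {D : W → UT Nf → UT Nf → ℝ} {ρ : ℝ}

/-- **σ-HOLOMORPHY OF THE KERNEL FROM TERMWISE σ-HOLOMORPHY** (memo T-54.1; Literature-side twin of the Summits-side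
`Spine.NE5.TwoRunPencilDiagonal.differentiableOn_sigma_of_termwise`): a joint walk expansion (drop `ε ≥ 0`) whose terms
`σ ↦ T_ω(σ,u)(i,j)` are complex differentiable on the OPEN `e^{κ₁}`-polydisc at a configuration `u` of the ball has
`σ ↦ K(σ,u)(i,j)` complex differentiable there — the tree's Cauchy-estimate theorem
`B13ExpansionAnalytic.differentiableOn_of_hasSum` (termwise differentiability + uniform majorants `A_ω e^{−ρD_ω}` + their
summability `majSum_full` + `hasSum`) on the sup-norm ball of the parameter space.
[cite: Balaban1988RG2Cluster, (1.11) p.5, p.15; Balaban1985BackgroundPropagators, Thm 3.10 p.416] -/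
theorem sigmaHol_of_termwise (h : JointWalkExpansion c locp locn K2 X R ε kap Kbar T2 SX A D ρ) (hε : 0 ≤ ε)
    {u : E} (hu : u ∈ ball (0 : E) R)
    (hTσ : ∀ ω i j, DifferentiableOn ℂ (fun σ => T2 ω σ u i j)
      {σ : TPt d N' → ℂ | ∀ j, σ j ∈ ball (0 : ℂ) (Real.exp c.κ₁)}) (i : p) (j : n) :
    DifferentiableOn ℂ (fun σ => K2 σ u i j) {σ : TPt d N' → ℂ | ∀ j, σ j ∈ ball (0 : ℂ) (Real.exp c.κ₁)} := by
  have hle : ∀ σ ∈ ball (0 : TPt d N' → ℂ) (Real.exp c.κ₁), ∀ j, ‖σ j‖ ≤ Real.exp c.κ₁ := fun σ hσ j => by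
    rw [← setOf_forall_mem_ball_eq_ball (Real.exp_pos _)] at hσ
    exact (mem_ball_zero_iff.1 (hσ j)).le
  rw [setOf_forall_mem_ball_eq_ball (Real.exp_pos _)] at hTσ ⊢
  have hMs : Summable fun ω => A ω * Real.exp (-(ρ * D ω (locp i) (locn j))) :=
    summable_of_sum_le (fun ω => mul_nonneg (h.A_nonneg ω) (Real.exp_pos _).le)
      fun Sf => h.majSum_full hε Sf (locp i) (locn j)
  exact differentiableOn_of_hasSum (F := fun ω σ => T2 ω σ u i j) (fun ω => hTσ ω i j)
    (fun ω σ hσ => h.maj ω σ (hle σ hσ) u hu i j) hMs (fun σ hσ => h.hasSum σ (hle σ hσ) u hu i j)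

end Kernel

section Monomial

/-- **AN `s`-MONOMIAL `σ ↦ ∏_{j ∈ J} σ_j` IS AN ENTIRE FUNCTION OF σ** (memo T-54.2 (a); twin of the Summits-side
`Spine.NE5.TwoRunTorusWalkFullModel.differentiable_monomial`). [cite: Balaban1988RG2Cluster, p.3, (1.11) p.5] -/
theorem differentiable_monomial [NeZero N'] (J : Finset (TPt d N')) :
    Differentiable ℂ (fun σ : TPt d N' → ℂ => ∏ j ∈ J, σ j) := by
  classical
  induction J using Finset.induction_on with
  | empty =>
    have h : (fun σ : TPt d N' → ℂ => ∏ j ∈ (∅ : Finset (TPt d N')), σ j) = fun _ => (1 : ℂ) := by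
      funext σ; rw [Finset.prod_empty]
    rw [h]
    exact differentiable_const (1 : ℂ)
  | insert a s ha ih =>
    have h : (fun σ : TPt d N' → ℂ => ∏ j ∈ insert a s, σ j) = fun σ => σ a * ∏ j ∈ s, σ j := by
      funext σ; rw [Finset.prod_insert ha]
    rw [h]
    have h1 : Differentiable ℂ (fun σ : TPt d N' → ℂ => σ a) := differentiable_apply (𝕜 := ℂ) a
    exact Differentiable.fun_mul (E := TPt d N' → ℂ) (𝔸 := ℂ) h1 ih

omit [NormedAddCommGroup E] [NormedSpace ℂ E] in
/-- **PRINT'S σ-STRUCTURE MAKES THE TERMWISE HYPOTHESIS FREE** (memo T-54.2 (b)): if every walk term is an `s`-monomial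
times a σ-free operator, `T_ω(σ,u) = (∏_{j ∈ J_ω} σ_j)·T⁰_ω(u)` (print p. 3: *"we multiply the term … corresponding to ω
by ∏ s(Δ_i)"*), then `σ ↦ T_ω(σ,u)(i,j)` is complex differentiable on every σ-region, at every configuration.
[cite: Balaban1988RG2Cluster, p.3, (1.11) p.5; Balaban1985BackgroundPropagators, (3.107) p.416] -/
theorem sigmaHol_term_of_monomial [NeZero N'] {W : Type} (J : W → Finset (TPt d N')) (T : W → E → Matrix p n ℂ)
    {T2 : W → (TPt d N' → ℂ) → E → Matrix p n ℂ} (hT2 : ∀ ω σ u, T2 ω σ u = (∏ j ∈ J ω, σ j) • T ω u)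
    (ω : W) (u : E) (i : p) (j : n) (U : Set (TPt d N' → ℂ)) :
    DifferentiableOn ℂ (fun σ => T2 ω σ u i j) U := by
  have h : (fun σ : TPt d N' → ℂ => T2 ω σ u i j) = fun σ => (∏ j' ∈ J ω, σ j') * T ω u i j := by
    funext σ; rw [hT2]; rfl
  rw [h]
  exact ((differentiable_monomial (J ω)).mul_const _).differentiableOn

end Monomial

/-! ## §2. Symmetry at complex (σ,u) from a reversal of the walk family -/

section Reversal

/-- **A CONVERGENT WALK SUM WITH A REVERSAL IS SYMMETRIC** (memo T-54.5 (a)): if `K(i,j) = Σ_ω T_ω(i,j)` (`HasSum`,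
entrywise) and the walk family carries a bijection `rev` with `T_{rev ω} = T_ωᵀ`, then `Kᵀ = K` — `HasSum` is invariant
under `Equiv` and limits are unique.  ([13] (3.107): the expansion of the symmetric operator `G` is built from symmetric
local resolvents, the reversed walk giving the transposed term; [II] (1.11): the cubes met by a walk, hence its
`s`-monomial, do not see the orientation.) [cite: Balaban1985BackgroundPropagators, (3.107) p.416; Balaban1988RG2Cluster, (1.11) p.5, p.15] -/
theorem isSymm_of_hasSum_reversal {q : Type} {W : Type} {T : W → Matrix q q ℂ} {K : Matrix q q ℂ}
    (hK : ∀ i j, HasSum (fun ω => T ω i j) (K i j)) (rev : W ≃ W) (hrev : ∀ ω i j, T (rev ω) i j = T ω j i) :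
    K.IsSymm := by
  refine Matrix.IsSymm.ext fun i j => ?_
  have h1 : HasSum (fun ω => T (rev ω) i j) (K i j) := (Equiv.hasSum_iff rev).2 (hK i j)
  have h2 : HasSum (fun ω => T ω j i) (K i j) := by simpa only [hrev] using h1
  exact (hK j i).unique h2

variable {c : B13.Consts}

/-- **SYMMETRY ON THE CLOSED POLYDISC × BALL FROM A REVERSAL OF THE EXPANSION** (memo T-54.5 (b)): a joint walk expansion
of a square kernel family (same location map on rows and columns) whose term family carries a reversal `rev`,
`T_{rev ω}(σ,u) = T_ω(σ,u)ᵀ` at every `(σ,u)`, has `K(σ,u)` symmetric at every σ of the CLOSED `e^{κ₁}`-polydisc and every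
`u` of the ball. [cite: Balaban1985BackgroundPropagators, (3.107) p.416; Balaban1988RG2Cluster, p.15] -/
theorem isSymm_of_reversal {q : Type} {loc : q → UT Nf} {K2 : (TPt d N' → ℂ) → E → Matrix q q ℂ}
    {X : Finset (UT Nf)} {R ε kap Kbar : ℝ} {W : Type} {T2 : W → (TPt d N' → ℂ) → E → Matrix q q ℂ} {SX : Set W}
    {A : W → ℝ} {D : W → UT Nf → UT Nf → ℝ} {ρ : ℝ}
    (h : JointWalkExpansion c loc loc K2 X R ε kap Kbar T2 SX A D ρ) (rev : W ≃ W)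
    (hrev : ∀ ω σ u i j, T2 (rev ω) σ u i j = T2 ω σ u j i) :
    ∀ σ : TPt d N' → ℂ, (∀ j, ‖σ j‖ ≤ Real.exp c.κ₁) → ∀ u ∈ ball (0 : E) R, (K2 σ u).IsSymm :=
  fun σ hσ u hu => isSymm_of_hasSum_reversal (fun i j => h.hasSum σ hσ u hu i j) rev (fun ω i j => hrev ω σ u i j)

end Reversal

/-! ## §3. At the ONE conditioned operator: the three letters of the record junctions from the expansion's structure -/

section Conditioned

variable [NeZero N'] {c : B13.Consts} {𝒦 : TermKernels c d N' ν Nf E}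
variable {K : (TPt d N' → ℂ) → E → Matrix (𝒦.Λ ⊕ 𝒦.C₀) (𝒦.Λ ⊕ 𝒦.C₀) ℂ}
variable {W : Type} {T : W → (TPt d N' → ℂ) → E → Matrix (𝒦.Λ ⊕ 𝒦.C₀) (𝒦.Λ ⊕ 𝒦.C₀) ℂ}
variable {SX : Set W} {A : W → ℝ} {D : W → UT Nf → UT Nf → ℝ} {ρ : ℝ}

omit [NeZero N'] in
/-- **`hAs` FROM THE REVERSAL**: under the block reading `A2 = K.toBlocks₁₁`, a joint walk expansion of `K` with a
reversal gives complex symmetry of the term precision `A2(σ,u)` on the closed polydisc × ball.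
[cite: Balaban1985BackgroundPropagators, (3.107) p.416; Balaban1988RG2Cluster, (2.5) p.12, p.15] -/
theorem isSymm_A2_of_reversal (hA2 : ∀ σ u, 𝒦.A2 σ u = (K σ u).toBlocks₁₁)
    {X : Finset (UT Nf)} {R ε kap Kbar : ℝ} (h : JointWalkExpansion c 𝒦.locN 𝒦.locN K X R ε kap Kbar T SX A D ρ)
    (rev : W ≃ W) (hrev : ∀ ω σ u i j, T (rev ω) σ u i j = T ω σ u j i)
    (σ : TPt d N' → ℂ) (hσ : ∀ j, ‖σ j‖ ≤ Real.exp c.κ₁) (u : E) (hu : u ∈ ball (0 : E) R) : (𝒦.A2 σ u).IsSymm := by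
  rw [hA2]
  exact isSymm_toBlocks₁₁ (isSymm_of_reversal h rev hrev σ hσ u hu)

/-- **`hAhol` FROM TERMWISE σ-HOLOMORPHY**: under the block reading, a joint walk expansion of `K` (drop `ε ≥ 0`) whose
terms are σ-holomorphic on the open polydisc at a configuration `u` of the ball gives σ-holomorphy of the entries of
`A2(·,u)` there. [cite: Balaban1988RG2Cluster, (2.5) p.12, p.15; Balaban1985BackgroundPropagators, Thm 3.10 p.416] -/
theorem differentiableOn_A2_of_termwise (hA2 : ∀ σ u, 𝒦.A2 σ u = (K σ u).toBlocks₁₁)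
    {X : Finset (UT Nf)} {R ε kap Kbar : ℝ} (h : JointWalkExpansion c 𝒦.locN 𝒦.locN K X R ε kap Kbar T SX A D ρ)
    (hε : 0 ≤ ε) {u : E} (hu : u ∈ ball (0 : E) R)
    (hTσ : ∀ ω k l, DifferentiableOn ℂ (fun σ => T ω σ u k l)
      {σ : TPt d N' → ℂ | ∀ j, σ j ∈ ball (0 : ℂ) (Real.exp c.κ₁)}) (i j : 𝒦.Λ) :
    DifferentiableOn ℂ (fun σ => 𝒦.A2 σ u i j) {σ : TPt d N' → ℂ | ∀ j, σ j ∈ ball (0 : ℂ) (Real.exp c.κ₁)} := by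
  have e : (fun σ => 𝒦.A2 σ u i j) = fun σ => (K σ u).toBlocks₁₁ i j := funext fun σ => by rw [hA2]
  rw [e]
  exact differentiableOn_toBlocks₁₁_apply (K := fun σ => K σ u) (sigmaHol_of_termwise h hε hu hTσ) i j

/-- **`hGhol` FROM TERMWISE σ-HOLOMORPHY, THE ONE POSITIVITY AND PRINT'S TWO THRESHOLDS**: under the block reading
`G2 = fromCols 0 K.toBlocks₁₂ · invSqrt K`, ONE joint walk expansion of `K` at a reference package's full-precision letters
whose terms are σ-holomorphic on the open polydisc at `u`, `m₀`-positivity of `Re K(0,0)`, far-ness, multiplicity,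
dimension, a radius `0 ≤ R₁ < R` with the two perturbative thresholds and `‖u‖ ≤ R₁`, `‖u‖ < R` give σ-holomorphy of
every entry of the Γ-kernel `G2(·,u)` on the open polydisc (`sigmaHol_of_termwise`, the uniform `m₀/2`-accretivity by
`accretive_of_conditionedBlocks_at`, then the square root (2.7) by `differentiableOn_offBlock_mul_invSqrt_apply`).
[cite: Balaban1988RG2Cluster, (2.5)–(2.7) pp.12–13, (2.14) p.15, (2.16) p.16; Balaban1985BackgroundPropagators, Thm 3.10 p.416, Thm 3.12 p.423] -/
theorem differentiableOn_G2_of_termwise [Fintype 𝒦.C₀] [DecidableEq 𝒦.C₀]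
    (hG2 : ∀ σ u, 𝒦.G2 σ u = Matrix.fromCols (0 : Matrix 𝒦.Λ 𝒦.Λ ℂ) (K σ u).toBlocks₁₂ * invSqrt (K σ u))
    (rf : RefPackage) (hrf : rf.Admissible)
    (h : JointWalkExpansion c 𝒦.locN 𝒦.locN K 𝒦.X rf.R rf.εP rf.kapP rf.KbarP T SX A D ρ)
    (hacc : ∀ v : 𝒦.Λ ⊕ 𝒦.C₀ → ℂ, rf.m₀ * ∑ i, ‖v i‖ ^ 2 ≤ (∑ i, star (v i) * (K 0 0 *ᵥ v) i).re)
    (hfar : ∀ k : 𝒦.Λ ⊕ 𝒦.C₀, ∀ z ∈ 𝒦.X, rf.Rσ ≤ tdist1 Nf (𝒦.locN k) z)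
    (hmult : ∀ x : UT Nf, (Finset.univ.filter fun k : 𝒦.Λ ⊕ 𝒦.C₀ => 𝒦.locN k = x).card ≤ rf.nB)
    (hdim : ν ≤ rf.dm) {R₁ : ℝ} (hR₁ : 0 ≤ R₁) (hR₁R : R₁ < rf.R)
    (hPσ : 8 * rf.KbarP * rf.cV₀ * Real.exp (-(rf.εP * rf.Rσ)) ≤ rf.m₀) (hP₁ : 8 * rf.KbarP * rf.cV₀ * R₁ ≤ rf.m₀ * rf.R)
    {u : E} (hu : ‖u‖ ≤ R₁)
    (hTσ : ∀ ω k l, DifferentiableOn ℂ (fun σ => T ω σ u k l)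
      {σ : TPt d N' → ℂ | ∀ j, σ j ∈ ball (0 : ℂ) (Real.exp c.κ₁)}) (i : 𝒦.Λ) (j : 𝒦.Λ ⊕ 𝒦.C₀) :
    DifferentiableOn ℂ (fun σ => 𝒦.G2 σ u i j) {σ : TPt d N' → ℂ | ∀ j, σ j ∈ ball (0 : ℂ) (Real.exp c.κ₁)} := by
  have huR : u ∈ ball (0 : E) rf.R := mem_ball_zero_iff.2 (hu.trans_lt hR₁R)
  have hKhol : ∀ k l, DifferentiableOn ℂ (fun σ => K σ u k l)
      {σ : TPt d N' → ℂ | ∀ j, σ j ∈ ball (0 : ℂ) (Real.exp c.κ₁)} :=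
    fun k l => sigmaHol_of_termwise h hrf.hεP huR hTσ k l
  have e : (fun σ => 𝒦.G2 σ u i j) = fun σ =>
      (Matrix.fromCols (0 : Matrix 𝒦.Λ 𝒦.Λ ℂ) (K σ u).toBlocks₁₂ * invSqrt (K σ u)) i j := funext fun σ => by rw [hG2]
  have hm : 0 < rf.m₀ / 2 := by linarith [hrf.hm₀]
  rw [e, setOf_forall_mem_ball_eq_ball (Real.exp_pos _)]
  refine differentiableOn_offBlock_mul_invSqrt_apply (fun σ => K σ u) hm (fun σ hσ v => ?_) (fun k l => ?_) i j
  · have hσ' : ∀ j, ‖σ j‖ ≤ Real.exp c.κ₁ := fun j => by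
      rw [← setOf_forall_mem_ball_eq_ball (Real.exp_pos _)] at hσ
      exact (mem_ball_zero_iff.1 (hσ j)).le
    exact accretive_of_conditionedBlocks_at rf hrf h hacc hfar hmult hdim hR₁ hR₁R hPσ hP₁ σ hσ' hu v
  · have hk := hKhol k l
    rwa [setOf_forall_mem_ball_eq_ball (Real.exp_pos _)] at hk

/-- **`hAhol` WITH NO REGULARITY HYPOTHESIS LEFT: the terms ARE `s`-monomials times σ-free operators** (print p. 3).
[cite: Balaban1988RG2Cluster, p.3, (1.11) p.5, (2.5) p.12, p.15; Balaban1985BackgroundPropagators, (3.107) p.416] -/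
theorem differentiableOn_A2_of_monomial (hA2 : ∀ σ u, 𝒦.A2 σ u = (K σ u).toBlocks₁₁)
    {X : Finset (UT Nf)} {R ε kap Kbar : ℝ} (h : JointWalkExpansion c 𝒦.locN 𝒦.locN K X R ε kap Kbar T SX A D ρ)
    (hε : 0 ≤ ε) (J : W → Finset (TPt d N')) (T0 : W → E → Matrix (𝒦.Λ ⊕ 𝒦.C₀) (𝒦.Λ ⊕ 𝒦.C₀) ℂ)
    (hT : ∀ ω σ u, T ω σ u = (∏ j ∈ J ω, σ j) • T0 ω u) {u : E} (hu : u ∈ ball (0 : E) R) (i j : 𝒦.Λ) :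
    DifferentiableOn ℂ (fun σ => 𝒦.A2 σ u i j) {σ : TPt d N' → ℂ | ∀ j, σ j ∈ ball (0 : ℂ) (Real.exp c.κ₁)} :=
  differentiableOn_A2_of_termwise hA2 h hε hu (fun ω k l => sigmaHol_term_of_monomial J T0 hT ω u k l _) i j

/-- **`hGhol` WITH NO REGULARITY HYPOTHESIS LEFT: the terms ARE `s`-monomials times σ-free operators** (print p. 3) —
what remains is the ONE expansion at the package's letters, the ONE positivity, geometry and print's two thresholds.
[cite: Balaban1988RG2Cluster, p.3, (1.11) p.5, (2.5)–(2.7) pp.12–13, (2.14) p.15, (2.16) p.16; Balaban1985BackgroundPropagators, Thm 3.10 p.416, Thm 3.12 p.423] -/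
theorem differentiableOn_G2_of_monomial [Fintype 𝒦.C₀] [DecidableEq 𝒦.C₀]
    (hG2 : ∀ σ u, 𝒦.G2 σ u = Matrix.fromCols (0 : Matrix 𝒦.Λ 𝒦.Λ ℂ) (K σ u).toBlocks₁₂ * invSqrt (K σ u))
    (rf : RefPackage) (hrf : rf.Admissible)
    (h : JointWalkExpansion c 𝒦.locN 𝒦.locN K 𝒦.X rf.R rf.εP rf.kapP rf.KbarP T SX A D ρ)
    (J : W → Finset (TPt d N')) (T0 : W → E → Matrix (𝒦.Λ ⊕ 𝒦.C₀) (𝒦.Λ ⊕ 𝒦.C₀) ℂ)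
    (hT : ∀ ω σ u, T ω σ u = (∏ j ∈ J ω, σ j) • T0 ω u)
    (hacc : ∀ v : 𝒦.Λ ⊕ 𝒦.C₀ → ℂ, rf.m₀ * ∑ i, ‖v i‖ ^ 2 ≤ (∑ i, star (v i) * (K 0 0 *ᵥ v) i).re)
    (hfar : ∀ k : 𝒦.Λ ⊕ 𝒦.C₀, ∀ z ∈ 𝒦.X, rf.Rσ ≤ tdist1 Nf (𝒦.locN k) z)
    (hmult : ∀ x : UT Nf, (Finset.univ.filter fun k : 𝒦.Λ ⊕ 𝒦.C₀ => 𝒦.locN k = x).card ≤ rf.nB)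
    (hdim : ν ≤ rf.dm) {R₁ : ℝ} (hR₁ : 0 ≤ R₁) (hR₁R : R₁ < rf.R)
    (hPσ : 8 * rf.KbarP * rf.cV₀ * Real.exp (-(rf.εP * rf.Rσ)) ≤ rf.m₀) (hP₁ : 8 * rf.KbarP * rf.cV₀ * R₁ ≤ rf.m₀ * rf.R)
    {u : E} (hu : ‖u‖ ≤ R₁) (i : 𝒦.Λ) (j : 𝒦.Λ ⊕ 𝒦.C₀) :
    DifferentiableOn ℂ (fun σ => 𝒦.G2 σ u i j) {σ : TPt d N' → ℂ | ∀ j, σ j ∈ ball (0 : ℂ) (Real.exp c.κ₁)} :=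
  differentiableOn_G2_of_termwise hG2 rf hrf h hacc hfar hmult hdim hR₁ hR₁R hPσ hP₁ hu
    (fun ω k l => sigmaHol_term_of_monomial J T0 hT ω u k l _) i j

end Conditioned

end Literature.MathematicalPhysics.QuantumFieldTheory.Balaban1983to89.B13ConditioningSigmaLetters

end
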